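import Summits.HodgeConjecture.HodgeConjecture.Theses.GenericDivisibility
import Literature.AlgebraicGeometry.HodgeTheory.SupportedClassesHodgeConiveauHolds
import Literature.AlgebraicGeometry.HodgeTheory.SupportedClassesRationalProofs
import Literature.AlgebraicGeometry.HodgeTheory.RationalLatticeIntegral
import Literature.AlgebraicGeometry.HodgeTheory.IntegralClassesCountable
import Literature.AlgebraicGeometry.HodgeTheory.HypersurfaceHodgeFiltrationProofs
import Literature.AlgebraicGeometry.HodgeTheory.HodgeFiltrationModels
import Literature.AlgebraicGeometry.HodgeTheory.ComplexConjugationHolds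
import Literature.AlgebraicGeometry.Motives.SmoothHypersurfaceExistenceProofs

/-!
# `HodgeClassesGenericallyDivisible` (C1, stmt-HodgeConjecture-18466) · Negative · the Hodge-type hypothesis

Negative knowledge for the crux `GenericDivisibility.HodgeClassesGenericallyDivisible` (route
GenericDivisibility, rank 2), from the standing disprover's work file
`Cruxes/HodgeClassesGenericallyDivisible/Disproof.lean` (§(a), hypothesis `IsOfHodgeType`):

* `not_forall_integral_middle_class_coniveau_one` — UNCONDITIONALLY, it is false that every integral
  middle-degree class on every smooth projective complex `2p`-fold has complexification of coniveau
  `≥ 1` (`supportedClasses X (2p) 1`): on a smooth quartic surface `Y ⊂ ℙ³_ℂ`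
  (`exists_isSmoothHypersurface_holds`) there is a non-zero class of type `(0,2)`
  (`Voisin2003_hypersurface_hodgePQ_zero_ne_bot_holds`, Griffiths' residue form), integral classes
  span `H²(Y(ℂ); ℂ)` over `ℂ` (`span_isRationalClass_eq_top_of_isSmoothProjective_holds` +
  `IsRationalClass.exists_nsmul_isIntegralClass`), and a class of type `(0,2)` supported in
  codimension `≥ 1` vanishes (Grothendieck 1969 / Deligne Hodge III Cor. 8.2.8, the tree's theorem
  `Grothendieck1969_supportedClasses_le_hodgeConiveau_holds`).  So the Hodge-type hypothesis of the
  census's generic-vanishing strengthening `MiddleIntegralHodgeConiveauOne` is load-bearing.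
* `hodgeClassesGenericallyDivisible_withoutHodgeType_false_of_bounded` — GRANTED THE ROUTE'S OWN
  HODGE-FREE CRUX C2 (`GenericDivisibilityBounded`, item 18467), the crux C1 with its hypothesis
  `IsOfHodgeType … p p` deleted is false: C1-without-Hodge-type feeds every integral middle class
  into C2, which returns coniveau `≥ 1` for all of them, contradicting the first theorem.  Equivalently
  `¬ (C1-without-Hodge-type ∧ C2)` unconditionally: any proof of C1 compatible with the route must
  use the Hodge type of `z` (at `p = 1`, C1 is exactly the integral Lefschetz `(1,1)` theorem).
Refuter seat refuter-cdisprove-stmt-HodgeConjecture-18466-0 (cdisprove cycle 1), 2026-08-17.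
-/

noncomputable section

-- The mandated namespace `Summit.<P>.<Sub>.Theorems.…` repeats `HodgeConjecture` (single-conjunct summit).
set_option linter.dupNamespace false

namespace Summit.HodgeConjecture.HodgeConjecture.Theorems.HodgeClassesGenericallyDivisible.Negative.HodgeType

open CategoryTheory AlgebraicGeometry
open Literature.AlgebraicGeometry.Motives Literature.AlgebraicGeometry.HodgeTheory
  Literature.AlgebraicTopology.SingularHomology
open Summit.HodgeConjecture.HodgeConjecture.Theses.GenericDivisibility (GenericDivisibilityBounded)

/-- **A smooth projective surface with a non-zero class of type `(0,2)`**: a smooth quartic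
`Y ⊂ ℙ³_ℂ` (Hartshorne II Ex. 8.20.2; `exists_isSmoothHypersurface_holds`) has `H^{0,2} ≠ 0` in
every Hodge model (Voisin II §6.1.3 / Cor. 6.12: the residue form; the tree's
`Voisin2003_hypersurface_hodgePQ_zero_ne_bot_holds`), and the pull-back to the model is onto
(`HodgeModel.pullback_surjective`). [cite: VoisinHodgeII2003, §6.1.3 and Cor. 6.12]
[cite: Hartshorne1977, II Example 8.20.2] -/
theorem exists_surface_class_zero_two_ne_zero :
    ∃ Y : SchemeOver ℂ, IsSmoothProjective 2 Y ∧
      ∃ c : complexBetti Y 2, IsOfHodgeType 2 Y 2 0 2 c ∧ c ≠ 0 := by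
  obtain ⟨Y, hY⟩ :=
    exists_isSmoothHypersurface_holds.{0}.complex (n := 2) (d := 4) (by norm_num) (by norm_num)
  obtain ⟨A⟩ := nonempty_hodgeModel_holds hY.1
  have hne : A.hodgePQ 2 0 2 ≠ ⊥ :=
    Voisin2003_hypersurface_hodgePQ_zero_ne_bot_holds 2 4 (by norm_num) (by norm_num) Y hY A
  obtain ⟨w, hw, hw0⟩ := (Submodule.ne_bot_iff _).1 hne
  obtain ⟨c, hc⟩ := A.pullback_surjective 2 w
  refine ⟨Y, hY.1, c, ⟨A, by rw [hc]; exact hw⟩, fun h0 ↦ hw0 ?_⟩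
  rw [← hc, h0, map_zero]

/-- **Not every integral middle-degree class has coniveau `≥ 1`** (unconditional): the statement
"for every `p ≥ 1`, every smooth projective complex `2p`-fold `X` and every `z ∈ H²ᵖ(X(ℂ); ℤ)`,
`z ⊗ 1 ∈ N¹H²ᵖ(X(ℂ); ℂ) = supportedClasses X (2p) 1`" is false.  Witness `p = 1` and the quartic
surface of `exists_surface_class_zero_two_ne_zero`: integral classes span `H²(Y(ℂ); ℂ)` (every
class is a combination of rational ones, `span_isRationalClass_eq_top_of_isSmoothProjective_holds`,
and a rational class has an integral multiple, `IsRationalClass.exists_nsmul_isIntegralClass`), so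
`N¹H² = H²`, whereas a non-zero `(0,2)`-class is never supported in codimension `≥ 1`
(Grothendieck's remark from Deligne's Cor. 8.2.8, `Grothendieck1969_supportedClasses_le_hodgeConiveau_holds`).
[cite: GrothendieckTopology1969, p. 300] [cite: DeligneHodgeIII1974, Cor. 8.2.8]
[cite: VoisinHodgeI2002, §7.1.1] -/
theorem not_forall_integral_middle_class_coniveau_one :
    ¬ (∀ ⦃p : ℕ⦄ ⦃X : SchemeOver ℂ⦄, 1 ≤ p → IsSmoothProjective (2 * p) X →
        ∀ z : singularCohomology ℤ ℤ (ComplexPoints X) (2 * p),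
          singularCohomology.ringChange (Int.castRingHom ℂ) (ComplexPoints X) (2 * p) z ∈
            supportedClasses X (2 * p) 1) := by
  intro h
  obtain ⟨Y, hY, c, hc, hc0⟩ := exists_surface_class_zero_two_ne_zero
  have h1 : ∀ z : singularCohomology ℤ ℤ (ComplexPoints Y) 2,
      singularCohomology.ringChange (Int.castRingHom ℂ) (ComplexPoints Y) 2 z ∈
        supportedClasses Y 2 1 :=
    fun z ↦ h (p := 1) le_rfl hY z
  -- every class of `H²(Y(ℂ); ℂ)` has coniveau `≥ 1`
  have htop : supportedClasses Y 2 1 = ⊤ := by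
    refine eq_top_iff.2 ?_
    rw [← span_isRationalClass_eq_top_of_isSmoothProjective_holds 2 Y hY 2]
    refine Submodule.span_le.2 fun a ha ↦ ?_
    obtain ⟨N, hN, hNa⟩ := IsRationalClass.exists_nsmul_isIntegralClass hY ha
    obtain ⟨z, hz⟩ := (isIntegralClass_iff_mem_range_ringChange _).1 hNa
    have hmem : (N : ℂ) • a ∈ supportedClasses Y 2 1 := hz ▸ h1 z
    have hNa' : a = (N : ℂ)⁻¹ • ((N : ℂ) • a) := by
      rw [smul_smul, inv_mul_cancel₀ (by exact_mod_cast hN.ne'), one_smul]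
    rw [SetLike.mem_coe, hNa']
    exact Submodule.smul_mem _ _ hmem
  exact hc0 (Grothendieck1969_supportedClasses_le_hodgeConiveau_holds.eq_zero_of_isOfHodgeType hY
    (show 0 + 2 = 2 from rfl) (Or.inl Nat.one_pos) (htop ▸ Submodule.mem_top) hc)

/-- **Granted the route's Hodge-free crux C2, the crux C1 WITHOUT its Hodge-type hypothesis is
false.**  The negated statement is `HodgeClassesGenericallyDivisible` with the hypothesis
`IsOfHodgeType (2p) X (2p) p p (z ⊗ 1)` deleted (everything else verbatim): every integral
middle-degree class would be `m`-divisible on a non-empty Zariski open for every `m ≥ 1`, hence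
(C2 = `GenericDivisibilityBounded`) of coniveau `≥ 1`, contradicting
`not_forall_integral_middle_class_coniveau_one`.  Equivalently, unconditionally,
`¬ (C1-without-Hodge-type ∧ C2)`: inside this route the Hodge type of `z` is load-bearing (at
`p = 1` C1 is the integral Lefschetz `(1,1)` theorem and nothing less).
[cite: GrothendieckTopology1969, p. 300] [cite: VoisinHodgeI2002, Thm. 11.30] -/
theorem hodgeClassesGenericallyDivisible_withoutHodgeType_false_of_bounded
    (h2 : GenericDivisibilityBounded) :
    ¬ (∀ ⦃p : ℕ⦄ ⦃X : SchemeOver ℂ⦄, 1 ≤ p → IsSmoothProjective (2 * p) X →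
        ∀ z : singularCohomology ℤ ℤ (ComplexPoints X) (2 * p),
          ∀ m : ℕ, 1 ≤ m → ∃ Z : Set X.left, IsClosed Z ∧ Z ≠ Set.univ ∧
            ∃ y : singularCohomology ℤ ℤ (complexPointsCompl X Z) (2 * p),
              m • y = singularCohomology.map ℤ ℤ
                (⟨Subtype.val, continuous_subtype_val⟩ :
                  C(complexPointsCompl X Z, ComplexPoints X)) (2 * p) z) := by
  intro h
  exact not_forall_integral_middle_class_coniveau_one fun _ _ hp hX z ↦ h2 hp hX z (h hp hX z)

end Summit.HodgeConjecture.HodgeConjecture.Theorems.HodgeClassesGenericallyDivisible.Negative.HodgeType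

end
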